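import Mathlib.Algebra.CharP.Two
import Summits.BirchSwinnertonDyer.BirchSwinnertonDyer.Theorems.ResidualThetaTransportAtTwoLambdaLowerBoundOEulerFactorQuadratic
import Literature.NumberTheory.EllipticCurves.GreenbergSelmerCharIdealPrincipalProofs
import Literature.NumberTheory.EllipticCurves.SharpFlatPAdicLFunctionCoeffField
import HarnessLib

/-!
# The two summands of the crux's `Σ_g(S₀)` as λ-invariants, in the crux's own currency (`p = 2`, `ℓ` odd):
# `Λ_𝒪/((Y² − aY + ℓ))` has rank `2^k·(if ‖a‖ < 1 then 2 else 0)` and `Λ_𝒪/((ℓ − aY))` has rank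
# `2^k·(if ‖a − 1‖ < 1 then 1 else 0)`, `Y = (1+T)^{2^k}`, over `𝒪 = padicCoeffIntegers S`, `Λ_𝒪 = IwasawaAlgebraO S`

Route `ResidualThetaTransportAtTwo` (RTT), crux (R≥)ᵖ `ResidualThetaCountLowerPureAtTwo`
(stmt-BirchSwinnertonDyer-26074), line «bt26-lambda», research stub S2 `stub_cmLambdaLower`, step (f5)
(imprimitivity, Greenberg–Vatsal local terms for the CM partner `g`); width seat `prover-bsd-rtt-w1` g0
(helper (H2); `--supports`, closes nothing). Sequel of `…LambdaLowerBoundOEulerFactorQuadratic` (general `p`,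
residue-field hypotheses). HONEST FRAMING: THEOREMS ONLY (no definition, no named fact, no instance, no
`sorry`); pure commutative algebra; nothing about any Selmer group or modular form is asserted; BSD is not
proved by any of this.

WHAT. The crux `ResidualThetaCountLowerPureAtTwo` inlines the CM-side imprimitivity sum as
`Σ_g(S₀) = ∑_{v ∈ S₀} 2^{v₂((ℓ_v²−1)/8)} · (if ℓ_v ∣ M then (if ‖ι a_{ℓ_v}(g) − 1‖ < 1 then 1 else 0)
else (if ‖ι a_{ℓ_v}(g)‖ < 1 then 2 else 0))`. With `k = v₂((ℓ²−1)/8)` (`2^k` = the number of primes of `ℚ_∞`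
above the odd prime `ℓ`) and `a = ι(a_ℓ(g)) ∈ 𝒪`, the two inner clauses ARE λ-invariants of the local
Euler-factor modules of `g` (GV Prop. 2.4 read over `𝒪` at `p = 2`: in characteristic `2` with `ℓ̄ = 1`,
`Ȳ² − āȲ + 1` has the double root `1` iff `ā = 0` and no root `1` otherwise; `ℓ̄ − āȲ̄`-type factor `ℓ − aY`
vanishes at `Y = 1` iff `ā = 1`):

* §1 `residue_eq_zero_iff_norm_lt_one` / `residue_eq_one_iff_norm_sub_one_lt_one` — in `𝒪_E ⊆ ℚ̄_p`,
  `ā = 0 ↔ ‖a‖ < 1` and `ā = 1 ↔ ‖a − 1‖ < 1`; `residue_natCast_eq_one_of_odd` (`ℓ̄ = 1` at `p = 2`);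
  **`free_finrank_quotient_span_eulerQuadratic_two`**, **`free_finrank_quotient_span_eulerLinear_two`** — over
  `𝒪_E`, `E/ℚ₂` finite: free of rank `2^k·(if ‖a‖ < 1 then 2 else 0)`, resp. `2^k·(if ‖a − 1‖ < 1 then 1 else 0)`.
* §2 the same on the crux's own carriers `𝒪 = padicCoeffIntegers S`, `Λ_𝒪 = IwasawaAlgebraO S`
  (`S = Set.range ι`; transport along `padicCoeffIntegers_eq_unitBall`):
  **`free_finrank_quotient_span_eulerQuadratic_iwasawaAlgebraO`**, **`…eulerLinear_iwasawaAlgebraO`**.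

References: [GreenbergVatsal2000] §2, Prop. 2.4 and Cor. 2.3; [Washington1997] §7.1 Thm. 7.3;
[NeukirchANT1999] Ch. II (4.8).
-/

set_option autoImplicit false
-- the Theorems namespace of this sub repeats the summit name by design (D-0017 nested layout)
set_option linter.dupNamespace false

noncomputable section

open scoped Classical
open PowerSeries

namespace Summit.BirchSwinnertonDyer.BirchSwinnertonDyer.Theorems.LambdaLowerBoundO

/-! ### §1. Norm clauses; the case `p = 2`, `ℓ` odd, over `𝒪_E` -/

section UnitBall

open Literature.NumberTheory.Automorphic

variable (p : ℕ) [Fact p.Prime] (E : IntermediateField ℚ_[p] (PadicAlgCl p))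


/-- In `𝒪_E ⊆ ℚ̄_p`: **`x ∈ 𝔪 ↔ ‖x‖ < 1`** (units have norm `1`, elements of norm `1` are units).
[cite: NeukirchANT1999, Ch. II (4.8)] -/
theorem residue_eq_zero_iff_norm_lt_one (x : PadicIntermediateField.unitBall p E) :
    IsLocalRing.residue (PadicIntermediateField.unitBall p E) x = 0 ↔ ‖(x : PadicAlgCl p)‖ < 1 := by
  rw [IsLocalRing.residue_eq_zero_iff, IsLocalRing.mem_maximalIdeal, mem_nonunits_iff]
  have hle : ‖(x : PadicAlgCl p)‖ ≤ 1 := by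
    have h := PadicIntermediateField.valued_le_one_of_mem_unitBall p E x.2
    rw [PadicAlgCl.valuation_def, ← NNReal.coe_le_coe, coe_nnnorm, NNReal.coe_one] at h
    exact h
  constructor
  · intro hnu
    refine lt_of_le_of_ne hle fun heq => hnu (PadicIntermediateField.isUnit_of_valued_eq_one p E ?_)
    rw [PadicAlgCl.valuation_def, ← NNReal.coe_inj, coe_nnnorm, NNReal.coe_one]
    exact heq
  · intro hlt hu
    have h1 := PadicIntermediateField.valued_eq_one_of_isUnit p E hu
    rw [PadicAlgCl.valuation_def, ← NNReal.coe_inj, coe_nnnorm, NNReal.coe_one] at h1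
    exact (ne_of_lt hlt) h1

/-- In `𝒪_E ⊆ ℚ̄_p`: **`x ≡ 1 (mod 𝔪) ↔ ‖x − 1‖ < 1`**. [cite: NeukirchANT1999, Ch. II (4.8)] -/
theorem residue_eq_one_iff_norm_sub_one_lt_one (x : PadicIntermediateField.unitBall p E) :
    IsLocalRing.residue (PadicIntermediateField.unitBall p E) x = 1 ↔ ‖(x : PadicAlgCl p) - 1‖ < 1 := by
  have h := residue_eq_zero_iff_norm_lt_one p E (x - 1)
  rw [map_sub, map_one, sub_eq_zero, AddSubgroupClass.coe_sub, OneMemClass.coe_one] at h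
  exact h

/-- In the residue field of `𝒪_E`, `E/ℚ₂` finite or not: an odd natural number reduces to `1`. [folklore] -/
theorem residue_natCast_eq_one_of_odd (E : IntermediateField ℚ_[2] (PadicAlgCl 2)) {l : ℕ} (hl : Odd l) :
    IsLocalRing.residue (PadicIntermediateField.unitBall 2 E) (l : PadicIntermediateField.unitBall 2 E) = 1 := by
  haveI := charP_residueField_unitBall 2 E
  have h2 : (2 : IsLocalRing.ResidueField (PadicIntermediateField.unitBall 2 E)) = 0 := CharTwo.two_eq_zero
  obtain ⟨m, rfl⟩ := hl
  rw [map_natCast, Nat.cast_add, Nat.cast_mul, Nat.cast_two, h2, zero_mul, zero_add, Nat.cast_one]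

/-- **The `ℓ ∤ M` summand of `Σ_g(S₀)` as a λ-invariant (`p = 2`, `ℓ` odd).** Over `𝒪 = 𝒪_E`, `E/ℚ₂` finite,
with `Y = (1+T)^{2^k}` and `a ∈ 𝒪`: `Λ_𝒪/((Y² − aY + ℓ))` is free over `𝒪` of rank
`2^k · (if ‖a‖ < 1 then 2 else 0)` — in characteristic `2` with `ℓ̄ = 1`, `P̄ = Ȳ² − āȲ + 1` has
`P̄(1) = P̄'(1) = ā`, so `1` is a double root iff `ā = 0` (`‖a‖ < 1`) and no root otherwise.
[cite: GreenbergVatsal2000, §2 Prop. 2.4] [cite: Washington1997, §7.1 Thm. 7.3] -/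
theorem free_finrank_quotient_span_eulerQuadratic_two (E : IntermediateField ℚ_[2] (PadicAlgCl 2))
    [FiniteDimensional ℚ_[2] E] (k : ℕ) (a : PadicIntermediateField.unitBall 2 E) {l : ℕ} (hl : Odd l) :
    Module.Free (PadicIntermediateField.unitBall 2 E)
        (PowerSeries (PadicIntermediateField.unitBall 2 E) ⧸
          Ideal.span {(((1 : PowerSeries (PadicIntermediateField.unitBall 2 E)) + X) ^ (2 ^ k)) ^ 2 -
            C a * ((1 : PowerSeries (PadicIntermediateField.unitBall 2 E)) + X) ^ (2 ^ k) +
            C (l : PadicIntermediateField.unitBall 2 E)}) ∧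
      Module.Finite (PadicIntermediateField.unitBall 2 E)
        (PowerSeries (PadicIntermediateField.unitBall 2 E) ⧸
          Ideal.span {(((1 : PowerSeries (PadicIntermediateField.unitBall 2 E)) + X) ^ (2 ^ k)) ^ 2 -
            C a * ((1 : PowerSeries (PadicIntermediateField.unitBall 2 E)) + X) ^ (2 ^ k) +
            C (l : PadicIntermediateField.unitBall 2 E)}) ∧
      Module.finrank (PadicIntermediateField.unitBall 2 E)
        (PowerSeries (PadicIntermediateField.unitBall 2 E) ⧸
          Ideal.span {(((1 : PowerSeries (PadicIntermediateField.unitBall 2 E)) + X) ^ (2 ^ k)) ^ 2 -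
            C a * ((1 : PowerSeries (PadicIntermediateField.unitBall 2 E)) + X) ^ (2 ^ k) +
            C (l : PadicIntermediateField.unitBall 2 E)}) =
        2 ^ k * (if ‖(a : PadicAlgCl 2)‖ < 1 then 2 else 0) := by
  haveI := charP_residueField_unitBall 2 E
  have hl1 := residue_natCast_eq_one_of_odd E hl
  have h2 : (2 : IsLocalRing.ResidueField (PadicIntermediateField.unitBall 2 E)) = 0 := CharTwo.two_eq_zero
  by_cases ha : IsLocalRing.residue (PadicIntermediateField.unitBall 2 E) a = 0
  · rw [if_pos ((residue_eq_zero_iff_norm_lt_one 2 E a).1 ha), show (2 : ℕ) ^ k * 2 = 2 * 2 ^ k from mul_comm _ _]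
    refine free_finrank_quotient_span_eulerQuadratic_of_eq_zero_of_eq_zero 2 E k ?_ ?_
    · rw [ha, hl1, sub_zero, one_add_one_eq_two]
      exact h2
    · rw [ha, sub_zero]
      exact h2
  · rw [if_neg (fun hn => ha ((residue_eq_zero_iff_norm_lt_one 2 E a).2 hn)), show (2 : ℕ) ^ k * 0 = 0 from mul_zero _]
    refine free_finrank_quotient_span_eulerQuadratic_of_ne_zero 2 E k ?_
    have hneg : (1 : IsLocalRing.ResidueField (PadicIntermediateField.unitBall 2 E)) -
        IsLocalRing.residue (PadicIntermediateField.unitBall 2 E) a + 1 =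
        -IsLocalRing.residue (PadicIntermediateField.unitBall 2 E) a := by
      rw [sub_add_eq_add_sub, one_add_one_eq_two, h2, zero_sub]
    rw [hl1, hneg]
    exact neg_ne_zero.2 ha

/-- **The `ℓ ∣ M` summand of `Σ_g(S₀)` as a λ-invariant (`p = 2`, `ℓ` odd).** Over `𝒪 = 𝒪_E`, `E/ℚ₂` finite,
with `Y = (1+T)^{2^k}` and `a ∈ 𝒪`: `Λ_𝒪/((ℓ − aY))` is free over `𝒪` of rank `2^k · (if ‖a − 1‖ < 1 then 1 else 0)`
(`ℓ̄ = 1`, so `ℓ̄ = ā` iff `ā = 1` iff `‖a − 1‖ < 1`). [cite: GreenbergVatsal2000, §2 Prop. 2.4]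
[cite: Washington1997, §7.1 Thm. 7.3] -/
theorem free_finrank_quotient_span_eulerLinear_two (E : IntermediateField ℚ_[2] (PadicAlgCl 2))
    [FiniteDimensional ℚ_[2] E] (k : ℕ) (a : PadicIntermediateField.unitBall 2 E) {l : ℕ} (hl : Odd l) :
    Module.Free (PadicIntermediateField.unitBall 2 E)
        (PowerSeries (PadicIntermediateField.unitBall 2 E) ⧸
          Ideal.span {C (l : PadicIntermediateField.unitBall 2 E) -
            C a * ((1 : PowerSeries (PadicIntermediateField.unitBall 2 E)) + X) ^ (2 ^ k)}) ∧
      Module.Finite (PadicIntermediateField.unitBall 2 E)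
        (PowerSeries (PadicIntermediateField.unitBall 2 E) ⧸
          Ideal.span {C (l : PadicIntermediateField.unitBall 2 E) -
            C a * ((1 : PowerSeries (PadicIntermediateField.unitBall 2 E)) + X) ^ (2 ^ k)}) ∧
      Module.finrank (PadicIntermediateField.unitBall 2 E)
        (PowerSeries (PadicIntermediateField.unitBall 2 E) ⧸
          Ideal.span {C (l : PadicIntermediateField.unitBall 2 E) -
            C a * ((1 : PowerSeries (PadicIntermediateField.unitBall 2 E)) + X) ^ (2 ^ k)}) =
        2 ^ k * (if ‖(a : PadicAlgCl 2) - 1‖ < 1 then 1 else 0) := by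
  have hl1 := residue_natCast_eq_one_of_odd E hl
  by_cases ha : IsLocalRing.residue (PadicIntermediateField.unitBall 2 E) a = 1
  · rw [if_pos ((residue_eq_one_iff_norm_sub_one_lt_one 2 E a).1 ha), show (2 : ℕ) ^ k * 1 = 2 ^ k from mul_one _]
    refine free_finrank_quotient_span_eulerLinear_of_eq 2 E k (hl1.trans ha.symm) ?_
    rw [ha]
    exact one_ne_zero
  · rw [if_neg (fun hn => ha ((residue_eq_one_iff_norm_sub_one_lt_one 2 E a).2 hn)), show (2 : ℕ) ^ k * 0 = 0 from mul_zero _]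
    refine free_finrank_quotient_span_eulerLinear_of_ne 2 E k ?_
    rw [hl1]
    exact Ne.symm ha

end UnitBall

/-! ### §2. The same over the crux's carriers `padicCoeffIntegers S`, `IwasawaAlgebraO S` -/

section CruxCurrency

open Literature.NumberTheory.Automorphic Literature.NumberTheory.EllipticCurves

variable (S : Set (PadicAlgCl 2)) [FiniteDimensional ℚ_[2] (padicCoeffField S)]

/-- **The `ℓ ∤ M` summand of the crux's `Σ_g(S₀)` is a λ-invariant**, on the crux's own carriers
`𝒪 = padicCoeffIntegers S`, `Λ_𝒪 = IwasawaAlgebraO S` (`S = Set.range ι`): for `a ∈ 𝒪` (read `a = ι(a_ℓ(g))`),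
`ℓ` odd and `k` (read `k = v₂((ℓ²−1)/8)`, `2^k` = the number of primes of `ℚ_∞` above `ℓ`), the quotient
`Λ_𝒪/((Y² − aY + ℓ))`, `Y = (1+T)^{2^k}`, is free over `𝒪` of rank `2^k · (if ‖a‖ < 1 then 2 else 0)` — the
crux's literal clause. [cite: GreenbergVatsal2000, §2 Prop. 2.4 and Cor. 2.3] [cite: Washington1997, §7.1 Thm. 7.3] -/
theorem free_finrank_quotient_span_eulerQuadratic_iwasawaAlgebraO :
    ∀ (k : ℕ) (a : padicCoeffIntegers S) (l : ℕ), Odd l →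
      Module.Free (padicCoeffIntegers S)
          (IwasawaAlgebraO S ⧸
            Ideal.span {(((1 : IwasawaAlgebraO S) + X) ^ (2 ^ k)) ^ 2 -
              C a * ((1 : IwasawaAlgebraO S) + X) ^ (2 ^ k) + C (l : padicCoeffIntegers S)}) ∧
        Module.Finite (padicCoeffIntegers S)
          (IwasawaAlgebraO S ⧸
            Ideal.span {(((1 : IwasawaAlgebraO S) + X) ^ (2 ^ k)) ^ 2 -
              C a * ((1 : IwasawaAlgebraO S) + X) ^ (2 ^ k) + C (l : padicCoeffIntegers S)}) ∧
        Module.finrank (padicCoeffIntegers S)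
          (IwasawaAlgebraO S ⧸
            Ideal.span {(((1 : IwasawaAlgebraO S) + X) ^ (2 ^ k)) ^ 2 -
              C a * ((1 : IwasawaAlgebraO S) + X) ^ (2 ^ k) + C (l : padicCoeffIntegers S)}) =
          2 ^ k * (if ‖(a : PadicAlgCl 2)‖ < 1 then 2 else 0) := by
  unfold IwasawaAlgebraO
  rw [padicCoeffIntegers_eq_unitBall S]
  intro k a l hl
  exact free_finrank_quotient_span_eulerQuadratic_two (padicCoeffField S) k a hl

/-- **The `ℓ ∣ M` summand of the crux's `Σ_g(S₀)` is a λ-invariant**, on the crux's own carriers: for `a ∈ 𝒪`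
(read `a = ι(a_ℓ(g))`), `ℓ` odd and `k`, the quotient `Λ_𝒪/((ℓ − aY))`, `Y = (1+T)^{2^k}`, is free over `𝒪` of
rank `2^k · (if ‖a − 1‖ < 1 then 1 else 0)` — the crux's literal clause. [cite: GreenbergVatsal2000, §2 Prop. 2.4
and Cor. 2.3] [cite: Washington1997, §7.1 Thm. 7.3] -/
theorem free_finrank_quotient_span_eulerLinear_iwasawaAlgebraO :
    ∀ (k : ℕ) (a : padicCoeffIntegers S) (l : ℕ), Odd l →
      Module.Free (padicCoeffIntegers S)
          (IwasawaAlgebraO S ⧸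
            Ideal.span {C (l : padicCoeffIntegers S) - C a * ((1 : IwasawaAlgebraO S) + X) ^ (2 ^ k)}) ∧
        Module.Finite (padicCoeffIntegers S)
          (IwasawaAlgebraO S ⧸
            Ideal.span {C (l : padicCoeffIntegers S) - C a * ((1 : IwasawaAlgebraO S) + X) ^ (2 ^ k)}) ∧
        Module.finrank (padicCoeffIntegers S)
          (IwasawaAlgebraO S ⧸
            Ideal.span {C (l : padicCoeffIntegers S) - C a * ((1 : IwasawaAlgebraO S) + X) ^ (2 ^ k)}) =
          2 ^ k * (if ‖(a : PadicAlgCl 2) - 1‖ < 1 then 1 else 0) := by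
  unfold IwasawaAlgebraO
  rw [padicCoeffIntegers_eq_unitBall S]
  intro k a l hl
  exact free_finrank_quotient_span_eulerLinear_two (padicCoeffField S) k a hl

end CruxCurrency

end Summit.BirchSwinnertonDyer.BirchSwinnertonDyer.Theorems.LambdaLowerBoundO

end
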